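import Summits.CriticalPhenomena.PercolationContinuityZ3.Theorems.PercNearOneGluingNoHeavyLowerTailKnQuestion8CoefficientwiseCoreClassKernelMixFull
import Summits.CriticalPhenomena.PercolationContinuityZ3.Theorems.PercNearOneGluingNoHeavyLowerTailKnQuestion8CoefficientwiseCoreClassDom
import HarnessLib

/-!
# KB-MIX-FULL from the COVER INEQUALITY (a domination map is not needed, only the transport inequality it certifies)

Support file (`--supports stmt-CriticalPhenomena-4575`, closed), prover `prim-cplus-coupling` (gen 35).  No definitions, no notations, no named facts,
no sorries; standard axioms.  Memo `prim-cplus-coupling/A5-COUPLING-gen35.md` §2.4(a).  Companions `…CoreClassKernelMixFull` (`coreClass_kernelMixFull_of_dom`,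
the map version), `…CoreClassDom` (`mul_add_sub_mul_sub_nonneg`).

Hall's condition for a domination map of `(E; a, b)` is, by LP duality, the family of COVER INEQUALITIES
`Σ_{ω ∈ wall} φ(C_a ω ∪ C_b(E∖ω)) ≤ Σ_{ω ⊆ E} φ(C_a ω ∪ C_b ω)` for all monotone `φ ≥ 0` on `Set V`.  KB-MIX-FULL at given test functions `h, k` needs exactly
ONE of them, `φ = h·k`:
* `Coefficientwise.coreClass_kernelMixFull_of_cover` — if `Σ_wall h(P ∪ Q)k(P ∪ Q) ≤ Σ_ω h(S)k(S)` (`P = C_a ω`, `Q = C_b(E∖ω)`, `S = C_a ω ∪ C_b ω`; `h, k` monotone)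
  then KB-MIX-FULL of `(E; a, b)` holds at every admissible levels `0 ≤ hᵃ, hᵇ ≤ h`, `0 ≤ kᵃ, kᵇ ≤ k`.  Proof: pointwise `h(P∪Q)k(P∪Q) + (hᵃP − hᵇQ)(kᵃP − kᵇQ) ≥ 0`.
So any future certificate of the cover inequality — an explicit map (`…_of_dom`), an averaging / fractional transport, or a counting argument — feeds the calculus
(LEAF, DECOR, SERIES, PAR) unchanged.
[cite: KozmaNitzan2024, Questions 8–9 (§5.5 p. 36) (context: the Question-8 pocket covariance programme)]
-/

namespace Summit.CriticalPhenomena.PercolationContinuityZ3.Theorems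

open Finset Literature.Probability.Percolation

namespace Coefficientwise

variable {ι V : Type*}

open Classical in
/-- **KB-MIX-FULL from the cover inequality.**  Middle graph `E`, terminals `a, b`, monotone `h, k`, levels `0 ≤ hᵃ, hᵇ ≤ h`, `0 ≤ kᵃ, kᵇ ≤ k`.  If
`Σ_{ω : b ∉ C_a ω, b ∉ C_a(E∖ω)} h(C_a ω ∪ C_b(E∖ω))·k(C_a ω ∪ C_b(E∖ω)) ≤ Σ_{ω ⊆ E} h(C_a ω ∪ C_b ω)·k(C_a ω ∪ C_b ω)` then
`0 ≤ Σ_{ω ⊆ E} h(S)k(S) + Σ_{wall} (hᵃ(C_a ω) − hᵇ(C_b(E∖ω)))(kᵃ(C_a ω) − kᵇ(C_b(E∖ω)))`.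
[cite: KozmaNitzan2024, Questions 8–9 (§5.5 p. 36) (context)] -/
theorem coreClass_kernelMixFull_of_cover (ends : ι → Sym2 V) (E : Finset ι) (a b : V) (h k ha hb ka kb : Set V → ℝ)
    (hh : Monotone h) (hk : Monotone k)
    (ha0 : ∀ X, 0 ≤ ha X) (hah : ∀ X, ha X ≤ h X) (hb0 : ∀ X, 0 ≤ hb X) (hbh : ∀ X, hb X ≤ h X)
    (ka0 : ∀ X, 0 ≤ ka X) (kak : ∀ X, ka X ≤ k X) (kb0 : ∀ X, 0 ≤ kb X) (kbk : ∀ X, kb X ≤ k X)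
    (hcover : ∑ ω ∈ E.powerset.filter (fun ω : Finset ι => b ∉ openCluster (ends '' (↑ω : Set ι)) a ∧ b ∉ openCluster (ends '' (↑(E \ ω) : Set ι)) a),
        h (openCluster (ends '' (↑ω : Set ι)) a ∪ openCluster (ends '' (↑(E \ ω) : Set ι)) b) *
          k (openCluster (ends '' (↑ω : Set ι)) a ∪ openCluster (ends '' (↑(E \ ω) : Set ι)) b)
      ≤ ∑ ω ∈ E.powerset,
        h (openCluster (ends '' (↑ω : Set ι)) a ∪ openCluster (ends '' (↑ω : Set ι)) b) *
          k (openCluster (ends '' (↑ω : Set ι)) a ∪ openCluster (ends '' (↑ω : Set ι)) b)) :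
    0 ≤ (∑ ω ∈ E.powerset,
        h (openCluster (ends '' (↑ω : Set ι)) a ∪ openCluster (ends '' (↑ω : Set ι)) b) *
          k (openCluster (ends '' (↑ω : Set ι)) a ∪ openCluster (ends '' (↑ω : Set ι)) b))
      + ∑ ω ∈ E.powerset.filter (fun ω : Finset ι => b ∉ openCluster (ends '' (↑ω : Set ι)) a ∧ b ∉ openCluster (ends '' (↑(E \ ω) : Set ι)) a),
        (ha (openCluster (ends '' (↑ω : Set ι)) a) - hb (openCluster (ends '' (↑(E \ ω) : Set ι)) b)) *
          (ka (openCluster (ends '' (↑ω : Set ι)) a) - kb (openCluster (ends '' (↑(E \ ω) : Set ι)) b)) := by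
  set C : Finset ι → V → Set V := fun ω x => openCluster (ends '' (↑ω : Set ι)) x with hC
  set T : Finset (Finset ι) := E.powerset.filter (fun ω : Finset ι => b ∉ C ω a ∧ b ∉ C (E \ ω) a) with hT
  change ∑ ω ∈ T, h (C ω a ∪ C (E \ ω) b) * k (C ω a ∪ C (E \ ω) b) ≤ ∑ ω ∈ E.powerset, h (C ω a ∪ C ω b) * k (C ω a ∪ C ω b) at hcover
  change 0 ≤ (∑ ω ∈ E.powerset, h (C ω a ∪ C ω b) * k (C ω a ∪ C ω b))
      + ∑ ω ∈ T, (ha (C ω a) - hb (C (E \ ω) b)) * (ka (C ω a) - kb (C (E \ ω) b))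
  -- pointwise: the wall term is bounded below by minus the cover term
  have hpt : ∀ ω ∈ T, -(h (C ω a ∪ C (E \ ω) b) * k (C ω a ∪ C (E \ ω) b)) ≤
      (ha (C ω a) - hb (C (E \ ω) b)) * (ka (C ω a) - kb (C (E \ ω) b)) := by
    intro ω _
    have key := mul_add_sub_mul_sub_nonneg (A := h (C ω a ∪ C (E \ ω) b)) (B := k (C ω a ∪ C (E \ ω) b))
      (α := ha (C ω a)) (β := hb (C (E \ ω) b)) (γ := ka (C ω a)) (δ := kb (C (E \ ω) b))
      (ha0 _) (le_trans (hah _) (hh Set.subset_union_left)) (hb0 _) (le_trans (hbh _) (hh Set.subset_union_right))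
      (ka0 _) (le_trans (kak _) (hk Set.subset_union_left)) (kb0 _) (le_trans (kbk _) (hk Set.subset_union_right))
    linarith
  have hsum : -(∑ ω ∈ T, h (C ω a ∪ C (E \ ω) b) * k (C ω a ∪ C (E \ ω) b)) ≤
      ∑ ω ∈ T, (ha (C ω a) - hb (C (E \ ω) b)) * (ka (C ω a) - kb (C (E \ ω) b)) := by
    rw [← Finset.sum_neg_distrib]
    exact Finset.sum_le_sum hpt
  linarith
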